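import Summits.CriticalPhenomena.SAWScalingLimit.Theorems.SAWDevelopingMapObservableToSLETypeLadderBandDefs
import Summits.CriticalPhenomena.SAWScalingLimit.Theorems.SAWDevelopingMapObservableToSLETypeLadderBandIterate
import Summits.CriticalPhenomena.SAWScalingLimit.Theorems.SAWDevelopingMapObservableToSLETypeLadderBandGoodRenewal
import Summits.CriticalPhenomena.SAWScalingLimit.Theorems.SAWDevelopingMapObservableToSLETypeLadderBandSplice
import HarnessLib

/-!
# The one-end band iteration at a fixed mesh (band iteration, piece I7b)

Crux `Summit.CriticalPhenomena.SAWScalingLimit.Theses.SAWDevelopingMap.ObservableToSLE`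
(item stmt-CriticalPhenomena-10472), line `six-class-type-ladder`, skeleton r16 (band-wise cut of the
abundance residue).  Self-registered stub `stub_bandAssembly`, the fixed-mesh core of the one-end
bound `stub_oneEndBound`:

at ONE mesh `δ > 0`, given `m ≥ 1` band families `B k` at the lattice root with separated scales
(inner radii `ρin k`, outer radii `θ·ρin k ≤ min (P k, r k) / 2`, protection radii
`P j ≤ ρin k / 2` for `j < k`, one lattice step `δ ≤ ρin k / 2`), each with the per-band carved bound
`≤ c₀` on the failure of adapted band success after every self-avoiding past confined to the closed
`ρin k`-ball, and given the no-macroscopic-backtracking bounds `≤ εNB` at `(P k / 2, r k)`, the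
spliced family `S` (piece I6) is a tame nested exterior-anchored class-`j` fat solid family with
`z₀`-escapes, levels within `R/2` of the rescaled root, and
`P(no good gate in S) ≤ m·εNB + c₀ ^ m`:
a list with band success at SOME band `k` and no backtracking at scale `k` has a good gate (piece I5,
transferred from `B k` to `S`, whose levels include those of `B k`), and ALL bands fail with
probability `≤ c₀ ^ m` (piece I7a `stub_bandIterate`, fed by piece I4 through
`bandSuccess_decided_of_le` and by the per-band bounds through `dist_tip_le_of_isPath`).
-/

noncomputable section

open scoped BigOperators Topology NNReal ENNReal Classical
open Filter Set MeasureTheory Metric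
open Literature.Probability.LatticeModels (HexVertex hexGraph hexCenter triZeta Site)
open Literature.Probability.RandomPlanarGeometry
open Literature.Probability.RandomPlanarGeometry.SAW

namespace Summit.CriticalPhenomena.SAWScalingLimit.Theorems.ObservableToSLE.TypeLadder

open Summit.CriticalPhenomena.SAWScalingLimit.Theorems.ObservableToSLER.BridgeGate
  (hexBall HasCleanWindow carvedLaw rowOf)
open Summit.CriticalPhenomena.SAWScalingLimit.Theorems.ObservableToSLER.NestedGate

/-! ### Transfer of good gates along level inclusions -/

/-- **A good gate at a level of `B` is a good gate at the same level of `S`** whenever every level of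
`B` is a level of `S` (good gates only read the level SET). -/
theorem goodRenewalAtN_of_levels {Ω : Set ℂ} {δ ρ R : ℝ} {S B : ℕ → Set HexVertex} {c : HexVertex}
    {l : List HexVertex} (hocc : ∀ n', ∃ n, S n = B n') (h : GoodRenewalAtN Ω δ ρ R B c l) :
    GoodRenewalAtN Ω δ ρ R S c l := by
  obtain ⟨n', i, p, q, hgate⟩ := h
  obtain ⟨n, hn⟩ := hocc n'
  refine ⟨n, i, p, q, ?_⟩
  unfold IsGoodGateN at hgate ⊢
  rw [hn]
  exact hgate

/-! ### The fixed-mesh assembly -/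

/-- Self-registered stub `stub_bandAssembly` (crux item stmt-CriticalPhenomena-10472, skeleton r16,
band iteration piece I7b): **the one-end band iteration at a fixed mesh.**  See the module docstring:
splice the `m` band families (`stub_spliceBandFamilies` at radius `R/2`), read the designer clauses off
the splice, cover the bad event `{no good gate in S}` by
`(⋃_{k<m} {backtracking at scale k}) ∪ (⋂_{k<m} {band k fails})` (`stub_goodRenewal_of_bandSuccess`
at the band `B k`, `goodRenewalAtN_of_levels`), and bound the two pieces by `m·εNB` (union bound) and
`c₀ ^ m` (`stub_bandIterate`: band `j < k` is decided by the exit prefix from the closed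
`ρin k / 2`-ball by `bandSuccess_decided_of_le`, as `θ·ρin j < P j ≤ ρin k / 2`; the tip of such a
prefix is within `ρin k / 2 + δ ≤ ρin k`, `dist_tip_le_of_isPath`, so the prefix is a confined past of
band `k` and the per-band bound applies). -/
theorem stub_bandAssembly :
    ∀ (Ω : Set ℂ) (δ ρ R θ c₀ εNB : ℝ) (zr z₀ w : ℂ) (N m : ℕ) (j : Fin 6) (root tgt : HexVertex)
      (P ρin r : ℕ → ℝ) (B : ℕ → ℕ → Set HexVertex), 0 < m → 0 ≤ c₀ → 0 ≤ εNB → 0 < δ → 1 ≤ θ →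
      (∀ k, k < m → 0 < P k ∧ P k ≤ R ∧ 0 < ρin k ∧ θ * ρin k ≤ P k / 2 ∧ θ * ρin k ≤ r k / 2) →
      (∀ j k : ℕ, j < k → k < m → P j ≤ ρin k / 2) →
      (∀ k, k + 1 < m → θ * ρin k ≤ ρin (k + 1)) →
      (∀ k, k < m → δ ≤ ρin k / 2) →
      (∀ k, k < m → dist ((δ : ℂ) * hexCenter root) zr ≤ P k / 4) →
      (∀ k, k < m → dist ((δ : ℂ) * hexCenter root) zr ≤ r k / 2) →
      2 * R ≤ dist z₀ ((δ : ℂ) * hexCenter root) →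
      R ≤ dist ((δ : ℂ) * hexCenter tgt) ((δ : ℂ) * hexCenter root) →
      (∀ k, k < m → BandFamily Ω δ (ρin k) (θ * ρin k) ρ (2 * R) z₀ w N j root (B k) ∧
        ∀ (t : HexVertex) (ω₀ : (hexDomainGraph Ω δ).Walk root t), ω₀.IsPath →
          (∀ v ∈ ω₀.support, dist ((δ : ℂ) * hexCenter v) ((δ : ℂ) * hexCenter root) ≤ ρin k) →
          carvedLaw Ω δ {v | v ∈ ω₀.support ∧ v ≠ t} t tgt
              {η | ¬ BandSuccess Ω δ ρ (P k) (B k) root (ω₀.support ++ η.walk.support.tail)} ≤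
            ENNReal.ofReal c₀) →
      (∀ k, k < m → hexSAWLaw Ω δ root tgt
          {γ | ∃ (l₁ l₂ : List HexVertex) (u v : HexVertex), γ.walk.support = l₁ ++ u :: l₂ ∧ v ∈ l₂ ∧
            P k / 2 ≤ dist ((δ : ℂ) * hexCenter u) zr ∧ dist ((δ : ℂ) * hexCenter v) zr ≤ r k} ≤
        ENNReal.ofReal εNB) →
      ∃ S : ℕ → Set HexVertex,
        TameNestedFamily δ R N root S ∧ (∀ n, ExteriorAnchored Ω δ (S n) root) ∧
        ClassWindows j Ω δ ρ S ∧ FatUnderWindowK j Ω δ ρ S root ∧ FatSpine δ ρ S root ∧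
        (∀ (n : ℕ) (p q : HexVertex), HasCleanWindow Ω δ ρ (S n) p q →
          ZEscape Ω δ ρ (2 * R) z₀ w (S n) q) ∧
        (∀ n, ∀ v ∈ S n, dist ((δ : ℂ) * hexCenter v) ((δ : ℂ) * hexCenter root) ≤ R / 2) ∧
        hexSAWLaw Ω δ root tgt {γ | ¬ GoodRenewalAtN Ω δ ρ R S root γ.walk.support} ≤
          ENNReal.ofReal (m * εNB + c₀ ^ m) := by
  intro Ω δ ρ R θ c₀ εNB zr z₀ w N m j root tgt P ρin r B hm hc hε hδ hθ hsc hdec hsep hstep hrootP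
    hrootr hz₀ htgt hB hNB
  -- `ρin k ≤ θ ρin k`, and `0 < R`
  have hρθ : ∀ k, k < m → ρin k ≤ θ * ρin k := fun k hk =>
    le_mul_of_one_le_left (hsc k hk).2.2.1.le hθ
  have hR : 0 < R := (hsc 0 hm).1.trans_le (hsc 0 hm).2.1
  -- splice the bands at radius `R / 2`
  obtain ⟨S, hT, hEA, hCW, hFU, hFS, hZE, -, hocc⟩ := stub_spliceBandFamilies Ω δ ρ (2 * R) (R / 2)
    z₀ w N m j root ρin (fun k => θ * ρin k) B hm (fun k hk => (hB k hk).1) (fun k hk => hsep k hk)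
    (fun k hk => by
      show θ * ρin k ≤ R / 2
      linarith [(hsc k hk).2.1, (hsc k hk).2.2.2.1])
  refine ⟨S, ⟨hT.1, hT.2.1, fun n v hv => (hT.2.2.1 n v hv).trans (by linarith), hT.2.2.2.1,
    hT.2.2.2.2⟩, hEA, hCW, hFU, hFS, hZE, hT.2.2.1, ?_⟩
  -- CLAIM 2: all bands fail with probability `≤ c₀ ^ m`
  have hiter : hexSAWLaw Ω δ root tgt
      {γ | ∀ k, k < m → ¬ BandSuccess Ω δ ρ (P k) (B k) root γ.walk.support} ≤
      ENNReal.ofReal (c₀ ^ m) := by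
    refine stub_bandIterate Ω δ c₀ root tgt m (fun k => ρin k / 2)
      (fun k l => ¬ BandSuccess Ω δ ρ (P k) (B k) root l) hc ?_ ?_ ?_
    · -- the target is beyond every conditioning radius
      intro k hk
      show ρin k / 2 < _
      linarith [(hsc k hk).2.1, (hsc k hk).2.2.1, (hsc k hk).2.2.2.1, hρθ k hk]
    · -- band `j' < k` is decided by the exit prefix from the closed `ρin k / 2`-ball
      intro j' k hj'k hk l i hi _ hfar
      have hj' : j' < m := hj'k.trans hk
      have hout : θ * ρin j' < P j' := by linarith [(hsc j' hj').1, (hsc j' hj').2.2.2.1]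
      exact not_congr (bandSuccess_decided_of_le (hB j' hj').1.2.2.2.1 hout (hdec j' k hj'k hk) l i
        hi hfar)
    · -- an exit prefix from the closed `ρin k / 2`-ball is a confined past of band `k`
      intro k hk t ω₀ hπ hS ht
      refine (hB k hk).2 t ω₀ hπ fun v hv => ?_
      by_cases hvt : v = t
      · rw [hvt]
        have h0 : dist ((δ : ℂ) * hexCenter root) ((δ : ℂ) * hexCenter root) ≤ ρin k / 2 := by
          rw [dist_self]
          linarith [(hsc k hk).2.2.1]
        have := dist_tip_le_of_isPath hδ.le ω₀ hπ hS h0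
        linarith [hstep k hk]
      · exact (hS v hv hvt).trans (by linarith [(hsc k hk).2.2.1])
  -- CLAIM 1: band success at some band and no backtracking at that scale give a good gate of `S`
  have hgood : ∀ l : List HexVertex,
      (∀ k, k < m → ¬ ∃ (l₁ l₂ : List HexVertex) (u v : HexVertex), l = l₁ ++ u :: l₂ ∧ v ∈ l₂ ∧
        P k / 2 ≤ dist ((δ : ℂ) * hexCenter u) zr ∧ dist ((δ : ℂ) * hexCenter v) zr ≤ r k) →
      (∃ k, k < m ∧ BandSuccess Ω δ ρ (P k) (B k) root l) → GoodRenewalAtN Ω δ ρ R S root l := by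
    rintro l hnoret ⟨k, hk, hsucc⟩
    obtain ⟨hPk, -, hρk, hθP, hθr⟩ := hsc k hk
    refine goodRenewalAtN_of_levels (hocc k hk) (stub_goodRenewal_of_bandSuccess Ω δ ρ R (P k)
      (θ * ρin k) (P k / 2) (r k) (2 * R) zr z₀ w (B k) root l hsucc (hnoret k hk) ?_
      (hB k hk).1.2.2.2.1 (by linarith) (by linarith [hrootP k hk]) (hB k hk).1.2.2.2.2.2.2.2.2.2.2 hz₀)
    -- the levels of band `k` are `r k`-close to `zr`
    intro n v hv
    have h1 := (hB k hk).1.2.2.2.1 n v hv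
    have h2 := hrootr k hk
    linarith [dist_triangle ((δ : ℂ) * hexCenter v) ((δ : ℂ) * hexCenter root) zr]
  -- hence the bad event is covered by the backtracking events and the all-fail event
  have hcover : {γ : HexDomainSAW Ω δ root tgt | ¬ GoodRenewalAtN Ω δ ρ R S root γ.walk.support} ⊆
      (⋃ k ∈ Finset.range m, {γ : HexDomainSAW Ω δ root tgt |
        ∃ (l₁ l₂ : List HexVertex) (u v : HexVertex), γ.walk.support = l₁ ++ u :: l₂ ∧ v ∈ l₂ ∧
          P k / 2 ≤ dist ((δ : ℂ) * hexCenter u) zr ∧ dist ((δ : ℂ) * hexCenter v) zr ≤ r k}) ∪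
      {γ | ∀ k, k < m → ¬ BandSuccess Ω δ ρ (P k) (B k) root γ.walk.support} := by
    intro γ hγ
    rw [Set.mem_union, or_iff_not_imp_left]
    intro hnoret k hk hsucc
    refine hγ (hgood γ.walk.support (fun k' hk' hret => hnoret ?_) ⟨k, hk, hsucc⟩)
    exact Set.mem_iUnion₂.2 ⟨k', Finset.mem_range.2 hk', hret⟩
  -- the estimate
  calc hexSAWLaw Ω δ root tgt {γ | ¬ GoodRenewalAtN Ω δ ρ R S root γ.walk.support}
      ≤ hexSAWLaw Ω δ root tgt ((⋃ k ∈ Finset.range m, {γ : HexDomainSAW Ω δ root tgt |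
          ∃ (l₁ l₂ : List HexVertex) (u v : HexVertex), γ.walk.support = l₁ ++ u :: l₂ ∧ v ∈ l₂ ∧
            P k / 2 ≤ dist ((δ : ℂ) * hexCenter u) zr ∧ dist ((δ : ℂ) * hexCenter v) zr ≤ r k}) ∪
          {γ | ∀ k, k < m → ¬ BandSuccess Ω δ ρ (P k) (B k) root γ.walk.support}) :=
        measure_mono hcover
    _ ≤ hexSAWLaw Ω δ root tgt (⋃ k ∈ Finset.range m, {γ : HexDomainSAW Ω δ root tgt |
          ∃ (l₁ l₂ : List HexVertex) (u v : HexVertex), γ.walk.support = l₁ ++ u :: l₂ ∧ v ∈ l₂ ∧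
            P k / 2 ≤ dist ((δ : ℂ) * hexCenter u) zr ∧ dist ((δ : ℂ) * hexCenter v) zr ≤ r k}) +
        hexSAWLaw Ω δ root tgt
          {γ | ∀ k, k < m → ¬ BandSuccess Ω δ ρ (P k) (B k) root γ.walk.support} :=
        measure_union_le _ _
    _ ≤ (∑ k ∈ Finset.range m, hexSAWLaw Ω δ root tgt {γ : HexDomainSAW Ω δ root tgt |
          ∃ (l₁ l₂ : List HexVertex) (u v : HexVertex), γ.walk.support = l₁ ++ u :: l₂ ∧ v ∈ l₂ ∧
            P k / 2 ≤ dist ((δ : ℂ) * hexCenter u) zr ∧ dist ((δ : ℂ) * hexCenter v) zr ≤ r k}) +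
        ENNReal.ofReal (c₀ ^ m) :=
        add_le_add (measure_biUnion_finset_le _ _) hiter
    _ ≤ (∑ _k ∈ Finset.range m, ENNReal.ofReal εNB) + ENNReal.ofReal (c₀ ^ m) :=
        add_le_add (Finset.sum_le_sum fun k hk => hNB k (Finset.mem_range.1 hk)) le_rfl
    _ = ENNReal.ofReal (m * εNB + c₀ ^ m) := by
        rw [Finset.sum_const, Finset.card_range, nsmul_eq_mul, ← ENNReal.ofReal_natCast,
          ← ENNReal.ofReal_mul (Nat.cast_nonneg _), ← ENNReal.ofReal_add (by positivity)
          (pow_nonneg hc _)]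

/-! ### Monotonicity of band families in the complexity -/

/-- A band family of complexity `N` is a band family of every larger complexity `N'` (only the clause
"each level is a union of at most `N` lattice hexagons" mentions it). -/
theorem bandFamily_mono {Ω : Set ℂ} {δ ρin ρout ρ Rfar : ℝ} {z₀ w : ℂ} {N N' : ℕ} {j : Fin 6}
    {c : HexVertex} {S : ℕ → Set HexVertex} (h : BandFamily Ω δ ρin ρout ρ Rfar z₀ w N j c S)
    (hN : N ≤ N') : BandFamily Ω δ ρin ρout ρ Rfar z₀ w N' j c S := by
  obtain ⟨h1, h2, h3, h4, h5, h6, h7⟩ := h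
  refine ⟨h1, h2, h3, h4, h5, fun n => ?_, h7⟩
  obtain ⟨L, hL, hLS⟩ := h6 n
  exact ⟨L, hL.trans hN, hLS⟩

end Summit.CriticalPhenomena.SAWScalingLimit.Theorems.ObservableToSLE.TypeLadder

end
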